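import Summits.NavierStokesRegularity.FunctionalMining.NoGo.TopEigHeatFrameCostLow
import Summits.NavierStokesRegularity.FunctionalMining.NoGo.TopEigHeatInverseGap
import Summits.NavierStokesRegularity.FunctionalMining.TopEigGapCutoffSmooth
import HarnessLib

/-!
# FunctionalMining / NoGo — K70: THE SEAMED TURNING FLOOR and THE FROZEN FRAME OF AN EXACT WITNESS
# `∫_{U_s} qλ₁^{q−1}(λ₁ − λ₂)|∇P₁|² ≤ FC_q(v) ≤ heatDissipation Φ_q v`, every real `q > 1`,
# eigenvalue crossings allowed

HONEST FRAMING. Search for candidate a priori estimates; no regularity claim. Nothing about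
Navier–Stokes is proved or asserted in this file. Cell `pub-nsfunc`, no-go seat (gen 55). Door (e) box
of `NOGO.md` (STRUCTURE ONLY): constraints on the SHAPE of a killing family / an exact witness for the
open node Lemma L-λ(q) = `TopEigHeatCoercivePos q` (door (b)/(F2) wants `¬ TopEigHeatCoercivePos q`;
`Φ_q = torusTopEigMoment q = ∫ (λ₁⁺)^q`, `λ₁ ≥ λ₂ ≥ λ₃` the strain eigenvalues of `v` on `T³`).
SETTING. `v` smooth and divergence free on `T³` — NO simplicity hypothesis: eigenvalue crossings,
seams and uniaxial wells are allowed. `U_s = simpleSet v = {λ₂ < λ₁}` (open, K63); `P₁ = topProj v` the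
tree's sign-free top projector (`TopEigProjectorDeriv`; chart-smooth at simple points,
`TopEigGapCutoffSmooth`); `G = topTurning v = Σₖᵢⱼ (∂ₖ(P₁)ᵢⱼ)²` (twice the squared turning rate of the top
eigen-line; junk off `U_s`); `w_q = qλ₁^{q−1}(λ₁ − λ₂)` the gap weight of K65; `fd = Δλ₁ − μ(S; S(Δv))`
the frame density and `FC_q = heatDissipation Φ_q v − AF_q` the frame cost of K62/K63
(`NoGo/TopEigHeatFrameFloor`, `NoGo/TopEigHeatFrameDensity`).
CONTENT. § 0 folklore tools on `T^d`: local constancy from vanishing torus partials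
(`eventuallyEq_of_partialDeriv_eq_zero`, through the chart `liftAt` and the mean value theorem on a
ball), constancy on preconnected sets (`eq_of_isPreconnected_of_nhds_eq`), and "a continuous `g ≥ 0` with
`∫_U g ≤ 0` on an open `U` vanishes on `U`" (`eq_zero_of_setIntegral_nonpos`; open sets have positive
measure). § 1 `G` is continuous on `U_s` and **`weight_mul_topTurning_le`**: `w_q G ≤ qλ₁^{q−1} fd` on
`U_s` (K65 § 1 `gap_mul_sum_sq_partialDeriv_topProj_le`, valid at every simple point of ANY smooth
field). § 2 **(R16) THE SEAMED TURNING FLOOR `setIntegral_simpleSet_weight_mul_topTurning_le`**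
(`q > 1`): `w_q G` is integrable on `U_s` and `∫_{U_s} w_q G ≤ FC_q(v) ≤ heatDissipation Φ_q v − AF_q(v)`
— K64's Fatou localisation `∫_{U_s} qλ₁^{q−1} fd ≤ FC_q` with § 1 inside; KILL-RULE FORM
**`…_le_of_heat_le`**: `heat ≤ cΦ_q(v)` ⇒ `∫_{U_s} w_q G ≤ cΦ_q(v)` (K65 § 4 had this for
EVERYWHERE-SIMPLE fields only). § 3 **THE FROZEN FRAME `topTurning_eq_zero_of_heat_nonpos`**: if
`heatDissipation Φ_q v ≤ 0` for ONE real `q > 1` (an EXACT WITNESS: heat price zero), then `G = 0` on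
`U_s`, i.e. every `∂ₖ(P₁)ᵢⱼ` vanishes on the simple set (§ 2 with `c = 0`, § 0, `w_q > 0` on `U_s`).
§ 4 **`topProj_eventuallyEq_of_heat_nonpos`**, **`topProj_eq_of_isPreconnected_of_heat_nonpos`**: the
top projector of an exact witness is LOCALLY CONSTANT on `U_s` and CONSTANT ON EVERY CONNECTED PIECE
of `U_s` — off the crossing set `{λ₁ = λ₂}` the top eigen-line of an exact witness does not turn at
all; and **`topEig_eq_sum_partialDeriv_mul_const_of_heat_nonpos`**: on such a piece `C ∋ x₀`,
`λ₁ = Σᵢⱼ (∂ᵢv)ⱼ (P₁(x₀))ᵢⱼ` is a constant-coefficient linear functional of `∇v` (exact witnesses are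
piecewise CONSTANT-SELECTION fields in the sense of F1 PART I Prop. 4, tree `TopEigSelectionBound`).
MEANING FOR (F2) (design rules (R16)–(R17), records only). (R16) Along ANY killing family
`heat Φ_q v_n ≤ c_nΦ_q(v_n)`, `c_n → 0` — seamed, laminated, with wells or not — the gap-weighted
turning of the top line on the simple set is `o(Φ_q)`:
`∫_{U_s(v_n)} qλ₁^{q−1}(λ₁−λ₂)|∇P₁|² ≤ c_nΦ_q(v_n)`; the frame may turn only where the gap closes
(K65's inverse-gap blow-up (R14) is the everywhere-simple shadow of this; on `{λ₂ ≤ (1−η)λ₁}` the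
weight is `≥ qηλ₁^q`). (R17) An exact witness (none is known; at `q = 2` K48
`exists_twin_of_exact_two` gives it a twin point `λ₁ = λ₂`) has a PIECEWISE FROZEN top frame: `P₁` is
constant on each component of `{λ₂ < λ₁}`, all turning is carried by the closed crossing set — the
kernel form of the door-(e) picture "wells and flat twin walls glued along seams" (F1 PART I §2; tree
`TopEigTwinWall`, `TopEigSelectionBound`).
NOT CLAIMED: existence or non-existence of an exact witness; anything on the crossing set itself; any
sign of `heatDissipation` in general; any verdict on L-λ(q): OPEN in the kernel for every real `q > 1`;
(F2) WANTED/OPEN; no node decided. [ours = §§ 1–4 as stated; folklore = § 0 (mean value theorem,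
open sets of positive Haar measure, preconnectedness), first-order perturbation of a simple eigenvalue
(Kato II-§5) — via the tree and K62–K65]
FILING (prove seat g31, REQUEST #99): declarations byte-identical to the no-go seat's staged `TopEigHeatFrozenFrame.STAGING.lean` deef0b2ce39526a5; this line is the only addition.
-/

noncomputable section

open Filter Topology Set MeasureTheory Finset
open scoped ContDiff

namespace Summit.NavierStokesRegularity.FunctionalMining

open Literature.Analysis Literature.Analysis.FunctionSpaces Literature.Analysis.FunctionSpaces.Torus
open TopEig.FrameFloor TopEig.InverseGap

namespace TopEig.FrozenFrame

/-! ## § 0 Folklore tools: chart pull-back, local constancy, preconnected sets, zero integrals -/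

section Chart

variable {d : Type*}

/-- Torus neighbourhoods pull back to chart neighbourhoods: a property of `y` near `x` holds for
`x + proj w`, `w` near `0`. [folklore] -/
theorem eventually_chart_of_nhds {x : UnitAddTorus d} {P : UnitAddTorus d → Prop}
    (h : ∀ᶠ y in 𝓝 x, P y) : ∀ᶠ w in 𝓝 (0 : EuclideanSpace ℝ d), P (x + proj w) := by
  have hc : Continuous fun w : EuclideanSpace ℝ d => x + proj w := continuous_const.add continuous_proj
  have ht : Tendsto (fun w : EuclideanSpace ℝ d => x + proj w) (𝓝 0) (𝓝 x) := by
    simpa [proj_zero] using hc.tendsto 0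
  exact ht.eventually h

/-- Continuity at `x` from continuity of the chart `liftAt g x` at `0` (`proj` is an open quotient
map). [folklore] -/
theorem continuousAt_of_liftAt {F : Type*} [TopologicalSpace F] {g : UnitAddTorus d → F}
    {x : UnitAddTorus d} (h : ContinuousAt (liftAt g x) 0) : ContinuousAt g x := by
  rw [ContinuousAt] at h ⊢
  rw [liftAt_apply_zero] at h
  refine tendsto_def.2 fun s hs => ?_
  have h' : ∀ᶠ w in 𝓝 (0 : EuclideanSpace ℝ d), g (x + proj w) ∈ s := by
    filter_upwards [h.eventually_mem hs] with w hw
    rwa [liftAt_apply] at hw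
  exact eventually_nhds_of_chart h'

/-- **Local constancy from vanishing partial derivatives.** If, for `y` near `x`, the chart of `f` at
`y` is smooth and all torus partial derivatives `∂ₖ f(y)` vanish, then `f` is constant near `x`
(the Fréchet derivative of `liftAt f x` vanishes on a ball; mean value theorem). [folklore] -/
theorem eventuallyEq_of_partialDeriv_eq_zero [Fintype d] [DecidableEq d] {f : UnitAddTorus d → ℝ}
    {x : UnitAddTorus d} (hf : ∀ᶠ y in 𝓝 x, ContDiffAt ℝ ∞ (liftAt f y) 0)
    (h0 : ∀ᶠ y in 𝓝 x, ∀ k, Torus.partialDeriv k f y = 0) :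
    ∀ᶠ y in 𝓝 x, f y = f x := by
  have h1 : ∀ᶠ w in 𝓝 (0 : EuclideanSpace ℝ d),
      DifferentiableAt ℝ (liftAt f x) w ∧ fderiv ℝ (liftAt f x) w = 0 := by
    filter_upwards [eventually_chart_of_nhds hf, eventually_chart_of_nhds h0] with w hw hw0
    have hd : DifferentiableAt ℝ (liftAt f x) w :=
      (contDiffAt_liftAt_of_shift hw).differentiableAt (by simp)
    have hb : ∀ k, fderiv ℝ (liftAt f x) w (EuclideanSpace.single k (1 : ℝ)) = 0 := fun k => by
      rw [← partialDeriv_eq_fderiv_liftAt hd k]; exact hw0 k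
    refine ⟨hd, ?_⟩
    ext V
    rw [show (0 : EuclideanSpace ℝ d →L[ℝ] ℝ) V = 0 from rfl,
      ← (EuclideanSpace.basisFun d ℝ).sum_repr V, map_sum]
    refine Finset.sum_eq_zero fun k _ => ?_
    rw [map_smul, EuclideanSpace.basisFun_apply, hb k, smul_zero]
  obtain ⟨r, hr, hball⟩ := Metric.eventually_nhds_iff_ball.1 h1
  have hconst : ∀ w ∈ Metric.ball (0 : EuclideanSpace ℝ d) r, liftAt f x w = liftAt f x 0 :=
    fun w hw => (convex_ball (0 : EuclideanSpace ℝ d) r).is_const_of_fderivWithin_eq_zero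
      (fun z hz => (hball z hz).1.differentiableWithinAt)
      (fun z hz => by rw [fderivWithin_of_isOpen Metric.isOpen_ball hz]; exact (hball z hz).2) hw
      (Metric.mem_ball_self hr)
  have h2 : ∀ᶠ w in 𝓝 (0 : EuclideanSpace ℝ d), f (x + proj w) = f x := by
    filter_upwards [Metric.ball_mem_nhds (0 : EuclideanSpace ℝ d) hr] with w hw
    have h := hconst w hw
    rwa [liftAt_apply, liftAt_apply_zero] at h
  exact eventually_nhds_of_chart h2

end Chart

section Topology

/-- A function that is locally constant at every point of an open set `U` is constant on every
preconnected `C ⊆ U`. [folklore] -/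
theorem eq_of_isPreconnected_of_nhds_eq {α β : Type*} [TopologicalSpace α] {f : α → β} {U C : Set α}
    (hU : IsOpen U) (hloc : ∀ x ∈ U, ∀ᶠ y in 𝓝 x, f y = f x) (hC : IsPreconnected C)
    (hCU : C ⊆ U) {x y : α} (hx : x ∈ C) (hy : y ∈ C) : f y = f x := by
  by_contra hne
  have hu : IsOpen {z | z ∈ U ∧ f z = f x} := by
    rw [isOpen_iff_eventually]
    rintro z ⟨hzU, hz⟩
    filter_upwards [hU.mem_nhds hzU, hloc z hzU] with y hyU hy
    exact ⟨hyU, hy.trans hz⟩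
  have hw : IsOpen {z | z ∈ U ∧ f z ≠ f x} := by
    rw [isOpen_iff_eventually]
    rintro z ⟨hzU, hz⟩
    filter_upwards [hU.mem_nhds hzU, hloc z hzU] with y hyU hy
    exact ⟨hyU, fun h => hz (hy.symm.trans h)⟩
  have hcover : C ⊆ {z | z ∈ U ∧ f z = f x} ∪ {z | z ∈ U ∧ f z ≠ f x} := fun z hz => by
    by_cases h : f z = f x
    exacts [Or.inl ⟨hCU hz, h⟩, Or.inr ⟨hCU hz, h⟩]
  obtain ⟨z, -, hzu, hzw⟩ := hC _ _ hu hw hcover ⟨x, hx, hCU hx, rfl⟩ ⟨y, hy, hCU hy, hne⟩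
  exact hzw.2 hzu.2

/-- A function continuous and nonnegative on an open set, integrable there with nonpositive integral,
vanishes on that set (open sets have positive measure). [folklore] -/
theorem eq_zero_of_setIntegral_nonpos {α : Type*} [TopologicalSpace α] [MeasurableSpace α]
    [OpensMeasurableSpace α] {μ : Measure α} [μ.IsOpenPosMeasure] {g : α → ℝ} {U : Set α}
    (hU : IsOpen U) (hg : ContinuousOn g U) (h0 : ∀ x ∈ U, 0 ≤ g x) (hint : IntegrableOn g U μ)
    (hI : ∫ x in U, g x ∂μ ≤ 0) {x : α} (hx : x ∈ U) : g x = 0 := by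
  by_contra hne
  have hpos : 0 < g x := lt_of_le_of_ne (h0 x hx) (Ne.symm hne)
  have hV : IsOpen (U ∩ g ⁻¹' Ioi (g x / 2)) := hg.isOpen_inter_preimage hU isOpen_Ioi
  have hxV : x ∈ U ∩ g ⁻¹' Ioi (g x / 2) :=
    ⟨hx, by simp only [Set.mem_preimage, Set.mem_Ioi]; linarith⟩
  have hVpos : 0 < μ (U ∩ g ⁻¹' Ioi (g x / 2)) := hV.measure_pos μ ⟨x, hxV⟩
  have hsupp : U ∩ g ⁻¹' Ioi (g x / 2) ⊆ Function.support g ∩ U := fun z hz =>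
    ⟨(lt_trans (half_pos hpos) hz.2).ne', hz.1⟩
  have hI' : 0 < ∫ x in U, g x ∂μ := by
    rw [setIntegral_pos_iff_support_of_nonneg_ae
      ((ae_restrict_iff' hU.measurableSet).2 (ae_of_all _ fun z hz => h0 z hz)) hint]
    exact lt_of_lt_of_le hVpos (measure_mono hsupp)
  linarith

end Topology

/-! ## § 1 The turning density `G = Σₖᵢⱼ (∂ₖ(P₁)ᵢⱼ)²` on `U_s`: continuity and `w_q G ≤ qλ₁^{q−1} fd` -/

section Three

variable {v : UnitAddTorus (Fin 3) → EuclideanSpace ℝ (Fin 3)} {q : ℝ}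

/-- THE TURNING DENSITY `G(x) := Σₖᵢⱼ (∂ₖ(P₁)ᵢⱼ(x))²` of the top projector `P₁ = topProj v`
(meaningful on the simple set, where `P₁` is smooth; junk-valued partials elsewhere). [ours, bookkeeping] -/
def topTurning (v : UnitAddTorus (Fin 3) → EuclideanSpace ℝ (Fin 3)) (x : UnitAddTorus (Fin 3)) : ℝ :=
  ∑ k, ∑ i, ∑ j, Torus.partialDeriv k (fun y => topProj v y i j) x ^ 2

/-- `G ≥ 0`. [ours, bookkeeping] -/
theorem topTurning_nonneg (v : UnitAddTorus (Fin 3) → EuclideanSpace ℝ (Fin 3)) (x : UnitAddTorus (Fin 3)) :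
    0 ≤ topTurning v x :=
  Finset.sum_nonneg fun _ _ => Finset.sum_nonneg fun _ _ => Finset.sum_nonneg fun _ _ => sq_nonneg _

/-- `G(x) = 0` iff every `∂ₖ(P₁)ᵢⱼ(x)` vanishes. [ours, bookkeeping] -/
theorem topTurning_eq_zero_iff (v : UnitAddTorus (Fin 3) → EuclideanSpace ℝ (Fin 3))
    (x : UnitAddTorus (Fin 3)) :
    topTurning v x = 0 ↔ ∀ k i j, Torus.partialDeriv k (fun y => topProj v y i j) x = 0 := by
  refine ⟨fun h k i j => ?_, fun h => ?_⟩
  · have h1 := (Finset.sum_eq_zero_iff_of_nonneg fun k _ =>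
      Finset.sum_nonneg fun i _ => Finset.sum_nonneg fun j _ => sq_nonneg _).1 h k (Finset.mem_univ _)
    have h2 := (Finset.sum_eq_zero_iff_of_nonneg fun i _ =>
      Finset.sum_nonneg fun j _ => sq_nonneg _).1 h1 i (Finset.mem_univ _)
    exact pow_eq_zero_iff two_ne_zero |>.1
      ((Finset.sum_eq_zero_iff_of_nonneg fun j _ => sq_nonneg _).1 h2 j (Finset.mem_univ _))
  · exact Finset.sum_eq_zero fun k _ => Finset.sum_eq_zero fun i _ => Finset.sum_eq_zero fun j _ => by
      rw [h k i j, zero_pow two_ne_zero]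

/-- At a simple point every `∂ₖ(P₁)ᵢⱼ` is continuous (chart smoothness of `P₁`; Kato II-§5).
[ours, bookkeeping] -/
theorem continuousAt_partialDeriv_topProj (hv : Torus.IsSmooth v) {x : UnitAddTorus (Fin 3)}
    (hx : x ∈ simpleSet v) (k i j : Fin 3) :
    ContinuousAt (Torus.partialDeriv k fun y => topProj v y i j) x :=
  continuousAt_of_liftAt
    (contDiffAt_liftAt_partialDeriv (contDiffAt_liftAt_topProj_of_simple hv hx i j) k).1.continuousAt

/-- The turning density is continuous on the simple set. [ours, bookkeeping] -/
theorem continuousOn_topTurning (hv : Torus.IsSmooth v) : ContinuousOn (topTurning v) (simpleSet v) :=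
  fun x hx => by
  have h : ContinuousAt (topTurning v) x :=
    tendsto_finsetSum _ fun k _ => tendsto_finsetSum _ fun i _ => tendsto_finsetSum _ fun j _ =>
      ((continuousAt_partialDeriv_topProj hv hx k i j).pow 2).tendsto
  exact h.continuousWithinAt

/-- `λ₁ > 0` on the simple set of a divergence-free field (`tr S = 0`). [ours, bookkeeping] -/
theorem topEig_pos_of_mem_simpleSet (hv : Torus.IsSmooth v) (hdv : Torus.IsDivFree v)
    {x : UnitAddTorus (Fin 3)} (hx : x ∈ simpleSet v) : 0 < torusStrainTopEig v x := by
  obtain ⟨e, he1, hSe, hg, hgap⟩ := exists_gapForm_of_midEig_lt_topEig hx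
  exact (lam_pos_of_gapForm_of_isDivFree hv hdv he1 hSe hg hgap).2

/-- The gap weight `w_q = qλ₁^{q−1}(λ₁ − λ₂)` is positive on the simple set (`q > 0`).
[ours, bookkeeping] -/
theorem weight_pos_of_mem_simpleSet (hq : 0 < q) (hv : Torus.IsSmooth v) (hdv : Torus.IsDivFree v)
    {x : UnitAddTorus (Fin 3)} (hx : x ∈ simpleSet v) :
    0 < q * torusStrainTopEig v x ^ (q - 1) * (torusStrainTopEig v x - torusStrainMidEig v x) :=
  mul_pos (mul_pos hq (Real.rpow_pos_of_pos (topEig_pos_of_mem_simpleSet hv hdv hx) _)) (sub_pos.2 hx)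

/-- **§ 1 `w_q G ≤ qλ₁^{q−1} fd` on the simple set** (K65 § 1 times `qλ₁^{q−1} ≥ 0`; `q ≥ 0`).
[ours] -/
theorem weight_mul_topTurning_le (hq : 0 ≤ q) (hv : Torus.IsSmooth v) (hdv : Torus.IsDivFree v)
    {x : UnitAddTorus (Fin 3)} (hx : x ∈ simpleSet v) :
    q * torusStrainTopEig v x ^ (q - 1) * (torusStrainTopEig v x - torusStrainMidEig v x) * topTurning v x ≤
      q * torusStrainTopEig v x ^ (q - 1) * frameDensity v x := by
  have h := gap_mul_sum_sq_partialDeriv_topProj_le hv hx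
  have hw : 0 ≤ q * torusStrainTopEig v x ^ (q - 1) :=
    mul_nonneg hq (Real.rpow_nonneg (topEig_pos_of_mem_simpleSet hv hdv hx).le _)
  calc q * torusStrainTopEig v x ^ (q - 1) * (torusStrainTopEig v x - torusStrainMidEig v x) * topTurning v x
      = q * torusStrainTopEig v x ^ (q - 1) *
          ((torusStrainTopEig v x - torusStrainMidEig v x) * topTurning v x) := by ring
    _ ≤ q * torusStrainTopEig v x ^ (q - 1) * frameDensity v x := mul_le_mul_of_nonneg_left h hw

/-! ## § 2 (R16) The seamed turning floor: `∫_{U_s} w_q G ≤ FC_q(v) ≤ heatDissipation Φ_q v`, `q > 1` -/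

/-- **§ 2 THE SEAMED TURNING FLOOR** (every real `q > 1`, every smooth divergence-free `v` on `T³`,
crossings allowed): `w_q G` is integrable on the simple set and
`∫_{U_s} qλ₁^{q−1}(λ₁−λ₂) G ≤ FC_q(v)`. [ours] -/
theorem setIntegral_simpleSet_weight_mul_topTurning_le (hq : 1 < q) (hv : Torus.IsSmooth v)
    (hdv : Torus.IsDivFree v) :
    IntegrableOn (fun x => q * torusStrainTopEig v x ^ (q - 1) *
        (torusStrainTopEig v x - torusStrainMidEig v x) * topTurning v x) (simpleSet v) volume ∧
      ∫ x in simpleSet v, q * torusStrainTopEig v x ^ (q - 1) *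
          (torusStrainTopEig v x - torusStrainMidEig v x) * topTurning v x ≤ frameCost q v := by
  have hU : MeasurableSet (simpleSet v) := (isOpen_simpleSet hv).measurableSet
  obtain ⟨hint, hle⟩ := setIntegral_simpleSet_frameDensity_le_frameCost_of_one_lt hq hv hdv
  have hm : AEStronglyMeasurable (fun x => q * torusStrainTopEig v x ^ (q - 1) *
      (torusStrainTopEig v x - torusStrainMidEig v x) * topTurning v x) (volume.restrict (simpleSet v)) :=
    (((continuous_strainGapWeight hq.le hv).continuousOn).mul (continuousOn_topTurning hv)).aestronglyMeasurable
      hU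
  have hdom : ∀ᵐ x ∂volume.restrict (simpleSet v),
      ‖q * torusStrainTopEig v x ^ (q - 1) * (torusStrainTopEig v x - torusStrainMidEig v x) *
          topTurning v x‖ ≤ q * torusStrainTopEig v x ^ (q - 1) * frameDensity v x :=
    (ae_restrict_iff' hU).2 (ae_of_all _ fun x hx => by
      rw [Real.norm_of_nonneg (mul_nonneg (weight_pos_of_mem_simpleSet (by linarith) hv hdv hx).le
        (topTurning_nonneg v x))]
      exact weight_mul_topTurning_le (by linarith) hv hdv hx)
  have hI : IntegrableOn (fun x => q * torusStrainTopEig v x ^ (q - 1) *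
      (torusStrainTopEig v x - torusStrainMidEig v x) * topTurning v x) (simpleSet v) volume :=
    hint.mono' hm hdom
  refine ⟨hI, le_trans (integral_mono_ae hI hint ?_) hle⟩
  filter_upwards [hdom] with x hx using le_trans (le_abs_self _) (Real.norm_eq_abs _ ▸ hx)

/-- **`∫_{U_s} w_q G ≤ heatDissipation Φ_q v − AF_q(v) ≤ heatDissipation Φ_q v`** (`q > 1`). [ours] -/
theorem setIntegral_simpleSet_weight_mul_topTurning_le_heatDissipation (hq : 1 < q) (hv : Torus.IsSmooth v)
    (hdv : Torus.IsDivFree v) :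
    ∫ x in simpleSet v, q * torusStrainTopEig v x ^ (q - 1) *
        (torusStrainTopEig v x - torusStrainMidEig v x) * topTurning v x ≤
      heatDissipation (torusTopEigMoment q) v - amplitudeIntegral q v ∧
    ∫ x in simpleSet v, q * torusStrainTopEig v x ^ (q - 1) *
        (torusStrainTopEig v x - torusStrainMidEig v x) * topTurning v x ≤
      heatDissipation (torusTopEigMoment q) v := by
  have h := (setIntegral_simpleSet_weight_mul_topTurning_le hq hv hdv).2
  have hA := amplitudeIntegral_nonneg hq.le hv hdv
  unfold frameCost at h
  exact ⟨h, by linarith⟩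

/-- **KILL RULE (R16), every real `q > 1`, NO simplicity hypothesis:** `heat ≤ c·Φ_q(v)` ⟹
`∫_{U_s} qλ₁^{q−1}(λ₁−λ₂) G ≤ c·Φ_q(v)` — along a killing family for L-λ(q) the gap-weighted
turning of the top eigen-line on the simple set is `o(Φ_q)`. [ours] -/
theorem setIntegral_simpleSet_weight_mul_topTurning_le_of_heat_le (hq : 1 < q) (hv : Torus.IsSmooth v)
    (hdv : Torus.IsDivFree v) {c : ℝ}
    (hc : heatDissipation (torusTopEigMoment q) v ≤ c * torusTopEigMoment q v) :
    ∫ x in simpleSet v, q * torusStrainTopEig v x ^ (q - 1) *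
        (torusStrainTopEig v x - torusStrainMidEig v x) * topTurning v x ≤ c * torusTopEigMoment q v :=
  (setIntegral_simpleSet_weight_mul_topTurning_le hq hv hdv).2.trans
    (amplitude_le_and_frameCost_le_of_heat_le_of_one_lt hq hv hdv hc).2

/-! ## § 3 (R17) The frozen frame: an exact witness does not turn on its simple set -/

/-- **§ 3 THE FROZEN FRAME.** If `heatDissipation Φ_q v ≤ 0` for one real `q > 1` (heat price zero:
an exact witness), then `G = 0` on the simple set. [ours] -/
theorem topTurning_eq_zero_of_heat_nonpos (hq : 1 < q) (hv : Torus.IsSmooth v) (hdv : Torus.IsDivFree v)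
    (h0 : heatDissipation (torusTopEigMoment q) v ≤ 0) {x : UnitAddTorus (Fin 3)} (hx : x ∈ simpleSet v) :
    topTurning v x = 0 := by
  have hc : heatDissipation (torusTopEigMoment q) v ≤ 0 * torusTopEigMoment q v := by rwa [zero_mul]
  have hI := setIntegral_simpleSet_weight_mul_topTurning_le_of_heat_le hq hv hdv hc
  rw [zero_mul] at hI
  have hz := eq_zero_of_setIntegral_nonpos (isOpen_simpleSet hv)
    (((continuous_strainGapWeight hq.le hv).continuousOn).mul (continuousOn_topTurning hv))
    (fun y hy => mul_nonneg (weight_pos_of_mem_simpleSet (by linarith) hv hdv hy).le (topTurning_nonneg v y))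
    (setIntegral_simpleSet_weight_mul_topTurning_le hq hv hdv).1 hI hx
  exact (mul_eq_zero.1 hz).resolve_left (weight_pos_of_mem_simpleSet (by linarith) hv hdv hx).ne'

/-- **Every `∂ₖ(P₁)ᵢⱼ` vanishes on the simple set of an exact witness.** [ours] -/
theorem partialDeriv_topProj_eq_zero_of_heat_nonpos (hq : 1 < q) (hv : Torus.IsSmooth v)
    (hdv : Torus.IsDivFree v) (h0 : heatDissipation (torusTopEigMoment q) v ≤ 0)
    {x : UnitAddTorus (Fin 3)} (hx : x ∈ simpleSet v) (k i j : Fin 3) :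
    Torus.partialDeriv k (fun y => topProj v y i j) x = 0 :=
  (topTurning_eq_zero_iff v x).1 (topTurning_eq_zero_of_heat_nonpos hq hv hdv h0 hx) k i j

/-! ## § 4 Local constancy: the top projector of an exact witness is frozen on each piece of `U_s` -/

/-- On the simple set: `G = 0` near `x` ⟹ `P₁` is constant near `x` (§ 0 entrywise). [ours] -/
theorem topProj_eventuallyEq_of_topTurning_eq_zero (hv : Torus.IsSmooth v) {x : UnitAddTorus (Fin 3)}
    (hx : x ∈ simpleSet v) (h0 : ∀ᶠ y in 𝓝 x, topTurning v y = 0) :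
    ∀ᶠ y in 𝓝 x, topProj v y = topProj v x := by
  have hsimple : ∀ᶠ y in 𝓝 x, y ∈ simpleSet v := (isOpen_simpleSet hv).mem_nhds hx
  have hent : ∀ i j, ∀ᶠ y in 𝓝 x, topProj v y i j = topProj v x i j := fun i j => by
    refine eventuallyEq_of_partialDeriv_eq_zero ?_ ?_
    · filter_upwards [hsimple] with y hy using contDiffAt_liftAt_topProj_of_simple hv hy i j
    · filter_upwards [h0] with y hy k using (topTurning_eq_zero_iff v y).1 hy k i j
  have hall : ∀ᶠ y in 𝓝 x, ∀ p : Fin 3 × Fin 3, topProj v y p.1 p.2 = topProj v x p.1 p.2 :=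
    eventually_all.2 fun p => hent p.1 p.2
  filter_upwards [hall] with y hy
  exact Matrix.ext fun i j => hy (i, j)

/-- **§ 4 THE TOP PROJECTOR OF AN EXACT WITNESS IS LOCALLY CONSTANT ON THE SIMPLE SET.** [ours] -/
theorem topProj_eventuallyEq_of_heat_nonpos (hq : 1 < q) (hv : Torus.IsSmooth v) (hdv : Torus.IsDivFree v)
    (h0 : heatDissipation (torusTopEigMoment q) v ≤ 0) {x : UnitAddTorus (Fin 3)} (hx : x ∈ simpleSet v) :
    ∀ᶠ y in 𝓝 x, topProj v y = topProj v x :=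
  topProj_eventuallyEq_of_topTurning_eq_zero hv hx (by
    filter_upwards [(isOpen_simpleSet hv).mem_nhds hx] with y hy
    exact topTurning_eq_zero_of_heat_nonpos hq hv hdv h0 hy)

/-- **… AND CONSTANT ON EVERY CONNECTED PIECE OF THE SIMPLE SET**: for a preconnected `C ⊆ U_s`,
`P₁` takes one value on `C` — the top eigen-line of an exact witness turns only across the crossing set
`{λ₁ = λ₂}`. [ours] -/
theorem topProj_eq_of_isPreconnected_of_heat_nonpos (hq : 1 < q) (hv : Torus.IsSmooth v)
    (hdv : Torus.IsDivFree v) (h0 : heatDissipation (torusTopEigMoment q) v ≤ 0)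
    {C : Set (UnitAddTorus (Fin 3))} (hC : IsPreconnected C) (hCU : C ⊆ simpleSet v)
    {x y : UnitAddTorus (Fin 3)} (hx : x ∈ C) (hy : y ∈ C) : topProj v y = topProj v x :=
  eq_of_isPreconnected_of_nhds_eq (isOpen_simpleSet hv)
    (fun _ hz => topProj_eventuallyEq_of_heat_nonpos hq hv hdv h0 hz) hC hCU hx hy

/-- **EXACT WITNESSES ARE PIECEWISE CONSTANT-SELECTION FIELDS**: on a preconnected piece `C ∋ x₀`
of the simple set, `λ₁(y) = Σᵢⱼ (∂ᵢv)ⱼ(y) (P₁(x₀))ᵢⱼ` — a CONSTANT-coefficient linear functional of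
`∇v` (so `λ₁` is smooth on `C` and F1 PART I Prop. 4, tree `TopEig.selectionDensity_const`, applies
there). [ours] -/
theorem topEig_eq_sum_partialDeriv_mul_const_of_heat_nonpos (hq : 1 < q) (hv : Torus.IsSmooth v)
    (hdv : Torus.IsDivFree v) (h0 : heatDissipation (torusTopEigMoment q) v ≤ 0)
    {C : Set (UnitAddTorus (Fin 3))} (hC : IsPreconnected C) (hCU : C ⊆ simpleSet v)
    {x₀ y : UnitAddTorus (Fin 3)} (hx₀ : x₀ ∈ C) (hy : y ∈ C) :
    torusStrainTopEig v y = ∑ i, ∑ j, Torus.partialDeriv i v y j * topProj v x₀ i j := by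
  rw [topEig_eq_sum_partialDeriv_mul_topProj y,
    topProj_eq_of_isPreconnected_of_heat_nonpos hq hv hdv h0 hC hCU hx₀ hy]

end Three

end TopEig.FrozenFrame

end Summit.NavierStokesRegularity.FunctionalMining

end
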